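import Literature.Analysis.FluidPDE.NSLerayHopf
import Literature.Analysis.FluidPDE.AlexakisDoering
import Literature.Analysis.FluidPDE.AlexakisDoeringInterpolation
import Literature.Analysis.FluidPDE.NSEnstrophyBalance2D
import Literature.Analysis.FluidPDE.LerayHopfSpectralMeasurability
import Literature.Analysis.FluidPDE.ZerothLawProofs
import Literature.Analysis.FunctionSpaces.TorusCalculusProofs
import HarnessLib

/-!
# The Alexakis–Doering bounds for Leray–Hopf solutions: proofs of the three displayed steps

Proof layer for the three named facts of `Literature.Analysis.FluidPDE.AlexakisDoering`
(Alexakis–Doering, *Energy and enstrophy dissipation in steady state 2d turbulence*, Phys. Lett.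
A 359 (2006), §2; arXiv:physics/0605090 v1, eqs. (16), (18), (21)), for Leray–Hopf solutions
on the flat torus driven by the Doering–Foias force `f = F Φ(n • ·)` (`ℓ = 1/n`):

* **eq. (18), the amplitude bound** `|F| ≤ a U²/ℓ + b ν U/ℓ²` — proved **unconditionally**, on
  `T^d` for every `d`, at the level of Leray–Hopf weak solutions
  (`abs_amplitude_le_of_isGlobalLerayHopf`): the time-sliced weak formulation
  (`Torus.IsLerayHopfOn.integral_inner_eq_add_setIntegral`) tested with `Ψ = Φ(n • ·)` gives
  `F t = ⟨u(t),Ψ⟩ - ⟨u₀,Ψ⟩ - ∫₀ᵗ∫⟪u,(u·∇)Ψ⟫ - ν∫₀ᵗ∫⟪u,ΔΨ⟫`; the energy inequality makes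
  `‖u(t)‖₂² = O(t)`; Cauchy–Schwarz for the running means and a `δ`-argument give
  `|F| ≤ ‖∇Ψ‖_∞ U² + ν‖ΔΨ‖_∞ U` with `‖∇(Φ(n • ·))‖_∞ = n‖∇Φ‖_∞`, `‖Δ(Φ(n • ·))‖_∞ = n²‖ΔΦ‖_∞`.
  This **discharges** `AlexakisDoering2006_amplitude_le` (`AlexakisDoering2006_amplitude_le_holds`).
* **eq. (16), `χ ≤ k_f² U F`**, and **eq. (21), `ε² ≤ ν U² χ`** — proved on `T^d` for every
  solution satisfying, individually, the two outputs of the 2-D theory: `u ∈ L²(0,T;H²)` for all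
  `T` and the integrated enstrophy *inequality*
  `ν∫₀ᵗ‖Δu‖₂² ≤ ½‖∇u₀‖₂² - ∫₀ᵗ∫⟪Δf, u⟫` (`meanEnstrophyDissipation_le_of_enstrophyIneq`,
  `meanDissipation_sq_le_of_enstrophyIneq`; the latter through the pure-analysis form
  `meanDissipation_sq_le_of_regular` of `AlexakisDoeringInterpolation` and the measurability /
  integrability lemmas of `LerayHopfSpectralMeasurability`). On `𝕋²` both hypotheses are
  supplied by the named fact `fmrt_enstrophy_balance_torus2` (Foias–Manley–Rosa–Temam 2001,
  Ch. II Thm. 7.4, (A.65); `NSEnstrophyBalance2D`), whence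
  `AlexakisDoering2006_enstrophyDissipation_le_of_enstrophyBalance` and
  `AlexakisDoering2006_dissipation_sq_le_of_enstrophyBalance`: the trust base of eqs. (16), (21)
  — and, through `Literature/Barriers/AnomalousDissipation/TwoDimensionalEnergyDissipationProofs`,
  of the barrier `AlexakisDoering2006_energyDissipationBound` — is that single 2-D regularity fact.

Supporting material (all proved): the dilation calculus of `x ↦ Φ(n • x)` on `T^d`
(`lineDeriv_comp_nsmul`, `laplacian_comp_nsmul`, `laplacian_force`, sup bounds), `‖·‖₁ ≤ ‖·‖₂`
on slices and running means, a `limsup` lemma, and the force-pairing bounds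
`|∫⟪a, u(s)⟫| ≤ ‖a‖_∞‖u(s)‖₁`.

## References

* A. Alexakis, C. R. Doering, Phys. Lett. A 359 (2006), 652–657, §2; arXiv:physics/0605090 v1,
  eqs. (16), (18), (21). [AlexakisDoering2006PLA]
* C. Foias, O. Manley, R. Rosa, R. Temam, *Navier–Stokes Equations and Turbulence*, CUP 2001,
  Ch. II Thm. 7.4, App. A (A.65)–(A.67). [FoiasManleyRosaTemam2001]
* C. R. Doering, C. Foias, J. Fluid Mech. 467 (2002), §§2–3 (the force `F Φ(x/ℓ)`, the
  multiplier argument).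

*Imports (module hygiene, 2026-08-16, refactor item `defn-NSLerayHopfOpenFacts`):* the hub
`Literature.Analysis.FluidPDE.NSLerayHopf` is imported explicitly (this file uses its
declarations), since `NSHopfGalerkin` — through which it used to arrive — no longer imports it.
-/

noncomputable section

open MeasureTheory TopologicalSpace Set Function Filter Topology
open scoped RealInnerProductSpace ENNReal NNReal

namespace Literature.Analysis.FluidPDE

open Literature.Analysis.FunctionSpaces

/-! ### Calculus of the dilation `x ↦ n • x` on the torus -/

section Dilation

variable {d : Type*} [Fintype d] [DecidableEq d] {F : Type*} [NormedAddCommGroup F]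
  [NormedSpace ℝ F]

omit [Fintype d] [DecidableEq d] in
/-- **Chain rule for directional derivatives under `x ↦ n • x`**:
`∂_v (f(n • ·))(x) = n ∂_v f (n • x)` (no differentiability needed: `deriv` of `t ↦ h(n t)`,
`deriv_comp_mul_left`, and `n • proj w = proj (n w)`). [folklore] -/
theorem lineDeriv_comp_nsmul (f : UnitAddTorus d → F) (n : ℕ) (x : UnitAddTorus d)
    (v : EuclideanSpace ℝ d) :
    Torus.lineDeriv (fun y => f (n • y)) x v = (n : ℝ) • Torus.lineDeriv f (n • x) v := by
  simp only [Torus.lineDeriv]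
  have h : (fun t : ℝ => f (n • (x + Torus.proj (t • v)))) =
      fun t => (fun s : ℝ => f (n • x + Torus.proj (s • v))) ((n : ℝ) * t) := by
    funext t
    simp only [smul_add, ← proj_natCast_smul, smul_smul]
  have key := deriv_comp_mul_left (n : ℝ) (fun s : ℝ => f (n • x + Torus.proj (s • v))) 0
  rw [mul_zero] at key
  rw [h, key]

omit [Fintype d] in
/-- Chain rule for partial derivatives under `x ↦ n • x`: `∂ᵢ(f(n • ·))(x) = n ∂ᵢf (n • x)`. [folklore] -/
theorem partialDeriv_comp_nsmul (f : UnitAddTorus d → F) (n : ℕ) (i : d) (x : UnitAddTorus d) :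
    Torus.partialDeriv i (fun y => f (n • y)) x = (n : ℝ) • Torus.partialDeriv i f (n • x) :=
  lineDeriv_comp_nsmul f n x _

omit [DecidableEq d] in
/-- `f(n • ·)` is smooth for smooth `f` (its lift is `lift f ∘ (n ·)`). [folklore] -/
theorem isSmooth_comp_nsmul {f : UnitAddTorus d → F} (hf : Torus.IsSmooth f) (n : ℕ) :
    Torus.IsSmooth (fun y => f (n • y)) := by
  unfold Torus.IsSmooth
  have h : Torus.lift (fun y => f (n • y)) = fun y => Torus.lift f ((n : ℝ) • y) := by
    funext y
    simp [Torus.lift, proj_natCast_smul]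
  rw [h]
  exact (hf : ContDiff ℝ _ (Torus.lift f)).comp (contDiff_const_smul (n : ℝ))

/-- Second partial derivatives under `x ↦ n • x`: `∂ᵢ∂ⱼ(f(n • ·))(x) = n² ∂ᵢ∂ⱼf (n • x)`. [folklore] -/
theorem partialDeriv_partialDeriv_comp_nsmul (f : UnitAddTorus d → F) (n : ℕ) (i j : d)
    (x : UnitAddTorus d) :
    Torus.partialDeriv i (Torus.partialDeriv j (fun y => f (n • y))) x =
      ((n : ℝ) ^ 2) • Torus.partialDeriv i (Torus.partialDeriv j f) (n • x) := by
  have h1 : Torus.partialDeriv j (fun y => f (n • y)) =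
      fun y => (n : ℝ) • Torus.partialDeriv j f (n • y) := by
    funext y; exact partialDeriv_comp_nsmul f n j y
  rw [h1, Torus.partialDeriv_const_smul_apply,
    partialDeriv_comp_nsmul (Torus.partialDeriv j f) n i x, smul_smul, sq]

/-- **Chain rule for the Laplacian under `x ↦ n • x`**: `Δ(f(n • ·))(x) = n² (Δf)(n • x)` for
smooth `f` (`Δ = ∑ᵢ ∂ᵢ∂ᵢ`, `Torus.laplacian_eq_sum_partialDeriv_partialDeriv`). [folklore] -/
theorem laplacian_comp_nsmul {f : UnitAddTorus d → F} (hf : Torus.IsSmooth f) (n : ℕ)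
    (x : UnitAddTorus d) :
    Torus.laplacian (fun y => f (n • y)) x = ((n : ℝ) ^ 2) • Torus.laplacian f (n • x) := by
  rw [Torus.laplacian_eq_sum_partialDeriv_partialDeriv (isSmooth_comp_nsmul hf n),
    Torus.laplacian_eq_sum_partialDeriv_partialDeriv hf, Finset.smul_sum]
  exact Finset.sum_congr rfl fun i _ => partialDeriv_partialDeriv_comp_nsmul f n i i x

/-- The Laplacian of the Doering–Foias force: `Δ(F Φ(n • ·))(x) = F n² (ΔΦ)(n • x)`. [folklore] -/
theorem laplacian_force (Φ : ForcingShape d) (n : ℕ) (F : ℝ) (x : UnitAddTorus d) :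
    Torus.laplacian (Φ.force n F) x = (F * (n : ℝ) ^ 2) • Torus.laplacian Φ.shape (n • x) := by
  have h : Φ.force n F = fun y => F • (fun z => Φ.shape (n • z)) y := rfl
  rw [h, Torus.laplacian_const_smul (isSmooth_comp_nsmul Φ.smooth n), laplacian_comp_nsmul Φ.smooth,
    smul_smul]

/-- **Sup bound for the Laplacian of the rescaled force**: there is `M ≥ 0` depending only on the
shape with `‖Δ(F Φ(n • ·))(x)‖ ≤ |F| n² M` for all `n, F, x` (`M = ‖ΔΦ‖_∞`). [folklore] -/
theorem exists_norm_laplacian_force_le (Φ : ForcingShape d) :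
    ∃ M : ℝ, 0 ≤ M ∧ ∀ (n : ℕ) (F : ℝ) (x : UnitAddTorus d),
      ‖Torus.laplacian (Φ.force n F) x‖ ≤ |F| * (n : ℝ) ^ 2 * M := by
  obtain ⟨M, hM, hb⟩ :=
    Torus.exists_nonneg_forall_norm_le_of_continuous Φ.smooth.laplacian.continuous
  refine ⟨M, hM, fun n F x => ?_⟩
  rw [laplacian_force, norm_smul, Real.norm_eq_abs, abs_mul, abs_pow, Nat.abs_cast]
  exact mul_le_mul_of_nonneg_left (hb _) (by positivity)


/-- **Sup bound for the gradient of the rescaled shape**: there is `D ≥ 0` depending only on the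
shape with `∑ᵢ ‖∂ᵢ(Φ(n • ·))(x)‖ ≤ n D` for all `n, x` (`D = ‖∑ᵢ‖∂ᵢΦ‖‖_∞`). [folklore] -/
theorem exists_sum_norm_partialDeriv_comp_nsmul_le (Φ : ForcingShape d) :
    ∃ D : ℝ, 0 ≤ D ∧ ∀ (n : ℕ) (x : UnitAddTorus d),
      ∑ i, ‖Torus.partialDeriv i (fun y => Φ.shape (n • y)) x‖ ≤ (n : ℝ) * D := by
  obtain ⟨D, hD, hb⟩ := Torus.exists_sum_norm_partialDeriv_le Φ.smooth
  refine ⟨D, hD, fun n x => ?_⟩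
  have h : ∀ i, ‖Torus.partialDeriv i (fun y => Φ.shape (n • y)) x‖ =
      (n : ℝ) * ‖Torus.partialDeriv i Φ.shape (n • x)‖ := fun i => by
    rw [partialDeriv_comp_nsmul, norm_smul, Real.norm_natCast]
  simp only [h, ← Finset.mul_sum]
  exact mul_le_mul_of_nonneg_left (hb _) (Nat.cast_nonneg n)

end Dilation

/-! ### Slice and time Cauchy–Schwarz in the form `‖·‖₁ ≤ ‖·‖₂` -/

section Jensen

variable {d : Type*} [Fintype d]

/-- `∫‖U‖ ≤ (∫‖U‖²)^{1/2}` on the probability space `T^d` (Cauchy–Schwarz against `1`). [folklore] -/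
theorem integral_norm_le_sqrt_integral_norm_sq {U : UnitAddTorus d → EuclideanSpace ℝ d}
    (hU : MemLp U 2 volume) : ∫ x, ‖U x‖ ≤ Real.sqrt (∫ x, ‖U x‖ ^ 2) := by
  have h := integral_le_sqrt_integral_mul_integral (μ := (volume : Measure (UnitAddTorus d)))
    (G := fun x => ‖U x‖) (E := fun x => ‖U x‖ ^ 2) (L := fun _ => (1 : ℝ))
    (ae_of_all _ fun x => norm_nonneg _) (ae_of_all _ fun x => sq_nonneg _)
    (ae_of_all _ fun x => zero_le_one) (ae_of_all _ fun x => by simp) hU.1.norm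
    (hU.integrable_norm_pow two_ne_zero) (integrable_const _)
  simpa using h

/-- `|∫⟪a, U⟫| ≤ K (∫‖U‖²)^{1/2}` for `U ∈ L²(T^d)` and `‖a‖ ≤ K`. [folklore] -/
theorem abs_integral_inner_le_mul_sqrt {a U : UnitAddTorus d → EuclideanSpace ℝ d}
    (hU : MemLp U 2 volume) {K : ℝ} (hK : 0 ≤ K) (ha : ∀ x, ‖a x‖ ≤ K) :
    |∫ x, ⟪a x, U x⟫| ≤ K * Real.sqrt (∫ x, ‖U x‖ ^ 2) := by
  have hcomm : (∫ x, ⟪a x, U x⟫) = ∫ x, ⟪U x, a x⟫ :=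
    integral_congr_ae (ae_of_all _ fun x => real_inner_comm _ _)
  rw [hcomm]
  exact (Torus.abs_integral_inner_le_of_norm_le (hU.integrable one_le_two) ha).trans
    (mul_le_mul_of_nonneg_left (integral_norm_le_sqrt_integral_norm_sq hU) hK)

/-- Running means: `T⁻¹∫₀ᵀ √E ≤ (T⁻¹∫₀ᵀ E)^{1/2}` for `E ≥ 0` integrable on `(0, T]`
(`timeMean_le_sqrt_timeMean_mul_timeMean` against `1`). [folklore] -/
theorem timeMean_sqrt_le_sqrt_timeMean {E : ℝ → ℝ} {T : ℝ} (hT : 0 < T) (hE0 : ∀ t, 0 ≤ E t)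
    (hE : IntegrableOn E (Ioc 0 T)) :
    timeMean (fun t => Real.sqrt (E t)) T ≤ Real.sqrt (timeMean E T) := by
  have h := timeMean_le_sqrt_timeMean_mul_timeMean (G := fun t => Real.sqrt (E t)) (E := E)
    (L := fun _ => (1 : ℝ)) hT (ae_of_all _ fun t => Real.sqrt_nonneg _)
    (ae_of_all _ fun t => hE0 t) (ae_of_all _ fun t => zero_le_one)
    (ae_of_all _ fun t => by rw [Real.sq_sqrt (hE0 t), mul_one])
    (Real.continuous_sqrt.comp_aestronglyMeasurable hE.aestronglyMeasurable)
    hE (integrableOn_const measure_Ioc_lt_top.ne)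
  have h1 : timeMean (fun _ => (1 : ℝ)) T = 1 := by
    rw [timeMean, intervalIntegral.integral_const, smul_eq_mul, mul_one, sub_zero,
      inv_mul_cancel₀ hT.ne']
  rwa [h1, mul_one] at h

end Jensen

/-! ### A `limsup` lemma -/

section Limsup

/-- If an eventually nonnegative real function satisfies `g ≤ h(δ)` eventually, for every
`δ > 0`, and `h(δ) → c` as `δ → 0⁺`, then `limsup g ≤ c`. [folklore] -/
theorem limsup_le_of_forall_pos_eventually_le {g h : ℝ → ℝ} {c : ℝ}
    (hg : ∀ᶠ t in atTop, 0 ≤ g t) (hδ : ∀ δ, 0 < δ → ∀ᶠ t in atTop, g t ≤ h δ)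
    (hh : Tendsto h (𝓝[>] 0) (𝓝 c)) : limsup g atTop ≤ c := by
  refine ge_of_tendsto hh ?_
  filter_upwards [self_mem_nhdsWithin] with δ hδpos
  exact limsup_le_of_le (isCoboundedUnder_le_of_eventually_le atTop hg) (hδ δ hδpos)

end Limsup

/-! ### Integrability of `√E` along a global Leray–Hopf solution -/

section SqrtEnergy

variable {d : Type*} [Fintype d] [DecidableEq d] {ν : ℝ}
  {f u : ℝ → UnitAddTorus d → EuclideanSpace ℝ d} {u₀ : UnitAddTorus d → EuclideanSpace ℝ d}

/-- Along a global Leray–Hopf solution, `t ↦ (‖u(t)‖₂²)^{1/2}` is integrable on every `(0, T]`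
(`√E ≤ ½(1 + E)`, `E` integrable). [folklore] -/
theorem Torus.IsGlobalLerayHopf.integrableOn_sqrt_integral_norm_sq
    (hu : Torus.IsGlobalLerayHopf ν f u₀ u) {T : ℝ} (hT : 0 < T) :
    IntegrableOn (fun s => Real.sqrt (∫ x, ‖u s x‖ ^ 2)) (Ioc 0 T) := by
  have hE := hu.integrableOn_integral_norm_sq hT
  haveI : IsFiniteMeasure (volume.restrict (Ioc (0 : ℝ) T)) :=
    isFiniteMeasure_restrict.mpr measure_Ioc_lt_top.ne
  refine Integrable.mono' (((integrable_const (1 : ℝ)).add hE).div_const 2)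
    (Real.continuous_sqrt.comp_aestronglyMeasurable hE.aestronglyMeasurable) ?_
  refine ae_of_all _ fun s => ?_
  rw [Real.norm_of_nonneg (Real.sqrt_nonneg _)]
  have h1 := two_mul_le_add_sq (Real.sqrt (∫ x, ‖u s x‖ ^ 2)) 1
  rw [Real.sq_sqrt (integral_nonneg fun x => sq_nonneg _)] at h1
  simp only [Pi.add_apply]
  linarith

end SqrtEnergy

/-! ### The force pairing `∫⟪Δf, u(s)⟫` is controlled by the energy -/

section Pairing

variable {d : Type*} [Fintype d] [DecidableEq d]

omit [DecidableEq d] in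
/-- `|∫⟪a, U⟫| ≤ ½ M (1 + ‖U‖₂²)` for `U ∈ L²(T^d)` and a field `a` bounded by `M ≥ 0`
(Cauchy–Schwarz substitute `∫‖U‖ ≤ ½(1 + ∫‖U‖²)` on the probability space `T^d`). [folklore] -/
theorem abs_integral_inner_le_half_mul_one_add {a U : UnitAddTorus d → EuclideanSpace ℝ d}
    (hU : MemLp U 2 volume) {M : ℝ} (hM : 0 ≤ M) (ha : ∀ x, ‖a x‖ ≤ M) :
    |∫ x, ⟪a x, U x⟫| ≤ 2⁻¹ * M * (1 + ∫ x, ‖U x‖ ^ 2) := by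
  have h1 : |∫ x, ⟪U x, a x⟫| ≤ M * ∫ x, ‖U x‖ :=
    Torus.abs_integral_inner_le_of_norm_le (hU.integrable one_le_two) ha
  have h2 := Torus.integral_norm_le_of_memLp_two hU
  have hcomm : (∫ x, ⟪a x, U x⟫) = ∫ x, ⟪U x, a x⟫ :=
    integral_congr_ae (ae_of_all _ fun x => real_inner_comm _ _)
  rw [hcomm]
  calc |∫ x, ⟪U x, a x⟫| ≤ M * ∫ x, ‖U x‖ := h1
    _ ≤ M * (2⁻¹ * (1 + ∫ x, ‖U x‖ ^ 2)) := mul_le_mul_of_nonneg_left h2 hM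
    _ = 2⁻¹ * M * (1 + ∫ x, ‖U x‖ ^ 2) := by ring

/-- **Time-integrated force pairing.** Along a global Leray–Hopf solution on `T^d` and for a
field `a` bounded by `M ≥ 0`: for `t > 0`,
`-∫₀ᵗ ∫⟪a, u(s)⟫ ds ≤ ½ M (t + ∫₀ᵗ ‖u(s)‖₂² ds)` (no integrability of the pairing is needed:
a non-integrable pairing has Bochner integral `0 ≤` right-hand side). [folklore] -/
theorem neg_setIntegral_integral_inner_le {ν : ℝ} {f u : ℝ → UnitAddTorus d → EuclideanSpace ℝ d}
    {u₀ : UnitAddTorus d → EuclideanSpace ℝ d} (hu : Torus.IsGlobalLerayHopf ν f u₀ u)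
    {a : UnitAddTorus d → EuclideanSpace ℝ d} {M : ℝ} (hM : 0 ≤ M) (ha : ∀ x, ‖a x‖ ≤ M)
    {t : ℝ} (ht : 0 < t) :
    -∫ s in Ioc 0 t, ∫ x, ⟪a x, u s x⟫ ≤
      2⁻¹ * M * (t + ∫ s in Ioc 0 t, ∫ x, ‖u s x‖ ^ 2) := by
  have hE := hu.integrableOn_integral_norm_sq ht
  haveI : IsFiniteMeasure (volume.restrict (Ioc (0 : ℝ) t)) :=
    isFiniteMeasure_restrict.mpr measure_Ioc_lt_top.ne
  have hdom : Integrable (fun s => 2⁻¹ * M * (1 + ∫ x, ‖u s x‖ ^ 2)) (volume.restrict (Ioc 0 t)) :=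
    ((integrable_const (1 : ℝ)).add hE).const_mul (2⁻¹ * M)
  have hbound : ∫ s in Ioc 0 t, ‖∫ x, ⟪a x, u s x⟫‖ ≤
      ∫ s in Ioc 0 t, 2⁻¹ * M * (1 + ∫ x, ‖u s x‖ ^ 2) := by
    refine integral_mono_of_nonneg (ae_of_all _ fun s => norm_nonneg _) hdom ?_
    filter_upwards [ae_restrict_mem measurableSet_Ioc] with s hs
    rw [Real.norm_eq_abs]
    exact abs_integral_inner_le_half_mul_one_add (hu.memLp_two hs.1.le) hM ha
  have hsplit : ∫ s in Ioc 0 t, 2⁻¹ * M * (1 + ∫ x, ‖u s x‖ ^ 2) =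
      2⁻¹ * M * (t + ∫ s in Ioc 0 t, ∫ x, ‖u s x‖ ^ 2) := by
    rw [integral_const_mul, integral_add (integrable_const _) hE]
    congr 2
    rw [setIntegral_const, Real.volume_real_Ioc_of_le ht.le, sub_zero, smul_eq_mul, mul_one]
  calc -∫ s in Ioc 0 t, ∫ x, ⟪a x, u s x⟫ ≤ ‖∫ s in Ioc 0 t, ∫ x, ⟪a x, u s x⟫‖ := by
        rw [Real.norm_eq_abs]; exact neg_le_abs _
    _ ≤ ∫ s in Ioc 0 t, ‖∫ x, ⟪a x, u s x⟫‖ := norm_integral_le_integral_norm _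
    _ ≤ _ := hbound.trans_eq hsplit

end Pairing

/-! ### Running means of `‖Δu‖₂²` under the enstrophy inequality -/

section EnstrophyMeans

variable {d : Type*} [Fintype d] [DecidableEq d] {ν : ℝ}
  {f : UnitAddTorus d → EuclideanSpace ℝ d} {u : ℝ → UnitAddTorus d → EuclideanSpace ℝ d}
  {u₀ : UnitAddTorus d → EuclideanSpace ℝ d}

/-- **Running means of `‖Δu‖₂²` under the enstrophy inequality.** For a global Leray–Hopf
solution on `T^d` with steady force `f`, `‖Δf‖ ≤ M`, satisfying the integrated enstrophy
inequality `ν∫₀ᵗ‖Δu‖₂² ≤ ½‖∇u₀‖₂² - ∫₀ᵗ∫⟪Δf, u⟫` (Foias–Manley–Rosa–Temam 2001, (A.65)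
integrated, `(f, Au) = (Af, u)`): for every `t > 0`,
`t⁻¹∫₀ᵗ ‖Δu‖₂² ≤ ‖∇u₀‖₂²/(2νt) + (M/2ν)(1 + t⁻¹∫₀ᵗ‖u‖₂²)` (cf. (A.67)). [cite: FoiasManleyRosaTemam2001, Ch. II (A.65)–(A.67)] -/
theorem timeMean_eLaplacianNormSq_le_of_enstrophyIneq (hν : 0 < ν)
    (hu : Torus.IsGlobalLerayHopf ν (fun _ => f) u₀ u) {M : ℝ} (hM : 0 ≤ M)
    (hfM : ∀ x, ‖Torus.laplacian f x‖ ≤ M)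
    (hineq : ∀ t, 0 < t → ν * ∫ s in Ioc 0 t, (eLaplacianNormSq (u s)).toReal ≤
      2⁻¹ * (Torus.eGradNormSq u₀).toReal - ∫ s in Ioc 0 t, ∫ x, ⟪Torus.laplacian f x, u s x⟫)
    {t : ℝ} (ht : 0 < t) :
    timeMean (fun s => (eLaplacianNormSq (u s)).toReal) t ≤
      (Torus.eGradNormSq u₀).toReal / (2 * ν * t) +
        M / (2 * ν) * (1 + timeMean (fun s => ∫ x, ‖u s x‖ ^ 2) t) := by
  have hdis := hineq t ht
  have hpair := neg_setIntegral_integral_inner_le hu hM hfM ht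
  set IL := ∫ s in Ioc 0 t, (eLaplacianNormSq (u s)).toReal with hIL
  set IE := ∫ s in Ioc 0 t, ∫ x, ‖u s x‖ ^ 2 with hIE
  set G₀ := (Torus.eGradNormSq u₀).toReal with hG₀
  have hkey : ν * IL ≤ 2⁻¹ * G₀ + 2⁻¹ * M * (t + IE) := by linarith
  have htmL : timeMean (fun s => (eLaplacianNormSq (u s)).toReal) t = t⁻¹ * IL := by
    rw [timeMean, intervalIntegral.integral_of_le ht.le]
  have htmE : timeMean (fun s => ∫ x, ‖u s x‖ ^ 2) t = t⁻¹ * IE := by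
    rw [timeMean, intervalIntegral.integral_of_le ht.le]
  rw [htmL, htmE]
  rw [show G₀ / (2 * ν * t) + M / (2 * ν) * (1 + t⁻¹ * IE) =
      t⁻¹ * ((2⁻¹ * G₀ + 2⁻¹ * M * (t + IE)) / ν) by field_simp]
  refine mul_le_mul_of_nonneg_left ?_ (inv_nonneg.mpr ht.le)
  rw [le_div_iff₀ hν]
  linarith

/-- **Eventually bounded running means of `‖Δu‖₂²`** under the enstrophy inequality, given
bounded running means of the energy (e.g. from `0 < U`): for `t ≥ 1` with `t⁻¹∫₀ᵗ‖u‖₂² ≤ b`,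
`t⁻¹∫₀ᵗ‖Δu‖₂² ≤ ‖∇u₀‖₂²/(2ν) + (‖Δf‖_∞/2ν)(1 + b)`. [cite: FoiasManleyRosaTemam2001, Ch. II (A.65)–(A.67)] -/
theorem isBoundedUnder_timeMean_eLaplacianNormSq_of_enstrophyIneq (hν : 0 < ν)
    (hf : Torus.IsSmooth f) (hu : Torus.IsGlobalLerayHopf ν (fun _ => f) u₀ u)
    (hineq : ∀ t, 0 < t → ν * ∫ s in Ioc 0 t, (eLaplacianNormSq (u s)).toReal ≤
      2⁻¹ * (Torus.eGradNormSq u₀).toReal - ∫ s in Ioc 0 t, ∫ x, ⟪Torus.laplacian f x, u s x⟫)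
    (hEb : IsBoundedUnder (· ≤ ·) atTop (timeMean fun s => ∫ x, ‖u s x‖ ^ 2)) :
    IsBoundedUnder (· ≤ ·) atTop (timeMean fun s => (eLaplacianNormSq (u s)).toReal) := by
  obtain ⟨M, hM, hfM⟩ := Torus.exists_nonneg_forall_norm_le_of_continuous hf.laplacian.continuous
  obtain ⟨b, hb⟩ := hEb
  rw [Filter.eventually_map] at hb
  set G₀ := (Torus.eGradNormSq u₀).toReal with hG₀
  have hG₀0 : 0 ≤ G₀ := ENNReal.toReal_nonneg
  refine ⟨G₀ / (2 * ν) + M / (2 * ν) * (1 + b), ?_⟩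
  rw [Filter.eventually_map]
  filter_upwards [hb, eventually_ge_atTop (1 : ℝ)] with t hbt ht1
  have ht : 0 < t := by linarith
  refine (timeMean_eLaplacianNormSq_le_of_enstrophyIneq hν hu hM hfM hineq ht).trans ?_
  have h1 : G₀ / (2 * ν * t) ≤ G₀ / (2 * ν) := by
    rw [mul_comm (2 * ν) t, ← div_div]
    exact div_le_div_of_nonneg_right (div_le_self hG₀0 ht1) (by positivity)
  have h2 : M / (2 * ν) * (1 + timeMean (fun s => ∫ x, ‖u s x‖ ^ 2) t) ≤
      M / (2 * ν) * (1 + b) :=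
    mul_le_mul_of_nonneg_left (by linarith) (by positivity)
  linarith

end EnstrophyMeans

/-! ### eq. (21): `ε² ≤ ν U² χ` -/

section TrickI

variable {d : Type*} [Fintype d] [DecidableEq d] {ν : ℝ}
  {f : UnitAddTorus d → EuclideanSpace ℝ d} {u : ℝ → UnitAddTorus d → EuclideanSpace ℝ d}
  {u₀ : UnitAddTorus d → EuclideanSpace ℝ d}

/-- **`ε² ≤ ν U² χ` under `L²_t H²_x` regularity and the enstrophy inequality** (Alexakis–Doering
2006, §2, arXiv v1 eq. (21) `⟨ω²⟩² ≤ ⟨|u|²⟩⟨|∇ω|²⟩`), on `T^d` for any `d`: for `ν > 0`, a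
smooth steady force `f`, and a global Leray–Hopf solution `u` with `U = ⟨‖u‖₂²⟩^{1/2} > 0` such
that `u ∈ L²(0,T;H²)` for every `T` and `ν∫₀ᵗ‖Δu‖₂² ≤ ½‖∇u₀‖₂² - ∫₀ᵗ∫⟪Δf, u⟫` for every `t > 0`,
one has `ε² ≤ ν U² χ` (`ε = meanDissipation ν u`, `χ = meanEnstrophyDissipation ν u`). In two
dimensions both hypotheses hold for smooth data (`fmrt_enstrophy_balance_torus2`). [cite: AlexakisDoering2006PLA, §2 eq. (21)] -/
theorem meanDissipation_sq_le_of_enstrophyIneq (hν : 0 < ν) (hf : Torus.IsSmooth f)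
    (hu : Torus.IsGlobalLerayHopf ν (fun _ => f) u₀ u)
    (hreg : ∀ T, 0 < T → Torus.MemL2Sobolev 0 T 2 (fun t => EuclideanSpace.complexify ∘ u t))
    (hineq : ∀ t, 0 < t → ν * ∫ s in Ioc 0 t, (eLaplacianNormSq (u s)).toReal ≤
      2⁻¹ * (Torus.eGradNormSq u₀).toReal - ∫ s in Ioc 0 t, ∫ x, ⟪Torus.laplacian f x, u s x⟫)
    (hU : 0 < rmsVelocity longTimeAvgSup u) :
    meanDissipation ν u ^ 2 ≤
      ν * rmsVelocity longTimeAvgSup u ^ 2 * meanEnstrophyDissipation ν u := by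
  have hEb := isBoundedUnder_timeMean_of_rmsVelocity_pos hU
  refine meanDissipation_sq_le_of_regular hν.le ?_ (hu.ae_eLaplacianNormSq_ne_top hreg)
    hu.aestronglyMeasurable_toReal_eGradNormSq (fun T hT => hu.integrableOn_integral_norm_sq hT)
    (fun T hT => (hu T hT).integrableOn_toReal_eLaplacianNormSq (hreg T hT)) hEb
    (isBoundedUnder_timeMean_eLaplacianNormSq_of_enstrophyIneq hν hf hu hineq hEb)
  filter_upwards [ae_restrict_mem measurableSet_Ioi] with t ht
  exact hu.memLp_two (le_of_lt ht)

/-- **`ε² ≤ ν U² χ` for 2-D Leray–Hopf solutions with smooth data, from the enstrophy balance**: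
on `𝕋²`, for `ν > 0`, `f` smooth steady divergence free and mean zero, `u₀` smooth and `u` a
global Leray–Hopf solution with `U > 0`, the named fact `fmrt_enstrophy_balance_torus2`
(Foias–Manley–Rosa–Temam 2001, Thm. 7.4, (A.65)) supplies the hypotheses of
`meanDissipation_sq_le_of_enstrophyIneq` (`u₀ ∈ V`: `H¹` by smoothness, weakly divergence free
as the datum of a Leray–Hopf solution). [cite: AlexakisDoering2006PLA, §2 eq. (21)] -/
theorem meanDissipation_sq_le_of_enstrophyBalance (hR : fmrt_enstrophy_balance_torus2) {ν : ℝ}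
    (hν : 0 < ν) {f : UnitAddTorus (Fin 2) → EuclideanSpace ℝ (Fin 2)} (hf : Torus.IsSmooth f)
    (hfdiv : Torus.IsDivFree f) (hfmean : Torus.HasZeroMean f)
    {u₀ : UnitAddTorus (Fin 2) → EuclideanSpace ℝ (Fin 2)} (hu₀ : Torus.IsSmooth u₀)
    {u : ℝ → UnitAddTorus (Fin 2) → EuclideanSpace ℝ (Fin 2)}
    (hu : Torus.IsGlobalLerayHopf ν (fun _ => f) u₀ u) (hU : 0 < rmsVelocity longTimeAvgSup u) :
    meanDissipation ν u ^ 2 ≤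
      ν * rmsVelocity longTimeAvgSup u ^ 2 * meanEnstrophyDissipation ν u := by
  have hRu := hR hν hf hfdiv hfmean hu₀.memSobolev_one_complexify hu.isWeaklyDivFree_datum hu
  exact meanDissipation_sq_le_of_enstrophyIneq hν hf hu hRu.1
    (fun _ ht => fmrt_enstrophy_balance_torus2.dissipation_integral_le hR hν hf hfdiv hfmean
      hu₀.memSobolev_one_complexify hu.isWeaklyDivFree_datum hu ht) hU

/-- **Discharge of eq. (21) relative to the 2-D enstrophy balance**: the named fact
`fmrt_enstrophy_balance_torus2` implies the Alexakis–Doering fact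
`AlexakisDoering2006_dissipation_sq_le` (`ε² ≤ ν U² χ` for the flows driven by `F Φ(n • x)`; the
rescaled force is smooth, divergence free and mean zero by `ForcingShape.force_regular_holds`). [cite: AlexakisDoering2006PLA, §2 eq. (21)] -/
theorem AlexakisDoering2006_dissipation_sq_le_of_enstrophyBalance
    (hR : fmrt_enstrophy_balance_torus2) : AlexakisDoering2006_dissipation_sq_le := by
  intro Φ ν hν n hn F u₀ u hu₀ hu hU
  obtain ⟨hsm, hdiv, hmean⟩ := ForcingShape.force_regular_holds Φ hn F
  exact meanDissipation_sq_le_of_enstrophyBalance hR hν hsm hdiv hmean hu₀ hu hU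

end TrickI

/-! ### eq. (16): `χ ≤ ‖Δf‖_∞ U` -/

section VBI

variable {d : Type*} [Fintype d] [DecidableEq d] {ν : ℝ}
  {f : UnitAddTorus d → EuclideanSpace ℝ d} {u : ℝ → UnitAddTorus d → EuclideanSpace ℝ d}
  {u₀ : UnitAddTorus d → EuclideanSpace ℝ d}

/-- **Running means of the enstrophy dissipation against the energy** under the enstrophy
inequality: for a global Leray–Hopf solution on `T^d` with steady force `f`, `‖Δf‖ ≤ K`, and
`ν∫₀ᵗ‖Δu‖₂² ≤ ½‖∇u₀‖₂² - ∫₀ᵗ∫⟪Δf, u⟫`: for `t > 0`,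
`ν t⁻¹∫₀ᵗ‖Δu‖₂² ≤ ‖∇u₀‖₂²/(2t) + K (t⁻¹∫₀ᵗ‖u‖₂²)^{1/2}` (Alexakis–Doering 2006, §2, the averaged
enstrophy balance with `|∫⟪Δf, u⟫| ≤ ‖Δf‖_∞‖u‖₁ ≤ ‖Δf‖_∞‖u‖₂`, Cauchy–Schwarz in time). [cite: AlexakisDoering2006PLA, §2 eq. (16)] -/
theorem timeMean_enstrophyDissipation_le_of_enstrophyIneq
    (hu : Torus.IsGlobalLerayHopf ν (fun _ => f) u₀ u) {K : ℝ} (hK : 0 ≤ K)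
    (hfK : ∀ x, ‖Torus.laplacian f x‖ ≤ K)
    (hineq : ∀ t, 0 < t → ν * ∫ s in Ioc 0 t, (eLaplacianNormSq (u s)).toReal ≤
      2⁻¹ * (Torus.eGradNormSq u₀).toReal - ∫ s in Ioc 0 t, ∫ x, ⟪Torus.laplacian f x, u s x⟫)
    {t : ℝ} (ht : 0 < t) :
    timeMean (fun s => ν * (eLaplacianNormSq (u s)).toReal) t ≤
      (Torus.eGradNormSq u₀).toReal / (2 * t) +
        K * Real.sqrt (timeMean (fun s => ∫ x, ‖u s x‖ ^ 2) t) := by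
  have hdis := hineq t ht
  have hE := hu.integrableOn_integral_norm_sq ht
  have hE0 : ∀ s, 0 ≤ ∫ x, ‖u s x‖ ^ 2 := fun s => integral_nonneg fun x => sq_nonneg _
  -- the force pairing against `√E`
  have hsqE := hu.integrableOn_sqrt_integral_norm_sq ht
  have hpair : -∫ s in Ioc 0 t, ∫ x, ⟪Torus.laplacian f x, u s x⟫ ≤
      K * ∫ s in Ioc 0 t, Real.sqrt (∫ x, ‖u s x‖ ^ 2) := by
    have hbound : ∫ s in Ioc 0 t, ‖∫ x, ⟪Torus.laplacian f x, u s x⟫‖ ≤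
        ∫ s in Ioc 0 t, K * Real.sqrt (∫ x, ‖u s x‖ ^ 2) := by
      refine integral_mono_of_nonneg (ae_of_all _ fun s => norm_nonneg _) (hsqE.const_mul K) ?_
      filter_upwards [ae_restrict_mem measurableSet_Ioc] with s hs
      rw [Real.norm_eq_abs]
      exact abs_integral_inner_le_mul_sqrt (hu.memLp_two hs.1.le) hK hfK
    calc -∫ s in Ioc 0 t, ∫ x, ⟪Torus.laplacian f x, u s x⟫
        ≤ ‖∫ s in Ioc 0 t, ∫ x, ⟪Torus.laplacian f x, u s x⟫‖ := by
          rw [Real.norm_eq_abs]; exact neg_le_abs _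
      _ ≤ ∫ s in Ioc 0 t, ‖∫ x, ⟪Torus.laplacian f x, u s x⟫‖ := norm_integral_le_integral_norm _
      _ ≤ K * ∫ s in Ioc 0 t, Real.sqrt (∫ x, ‖u s x‖ ^ 2) := by
          rw [← integral_const_mul]; exact hbound
  -- the inequality between integrals over `(0, t]`
  set IL := ∫ s in Ioc 0 t, (eLaplacianNormSq (u s)).toReal with hIL
  set IS := ∫ s in Ioc 0 t, Real.sqrt (∫ x, ‖u s x‖ ^ 2) with hIS
  set G₀ := (Torus.eGradNormSq u₀).toReal with hG₀
  have hkey : ν * IL ≤ 2⁻¹ * G₀ + K * IS := by linarith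
  -- pass to running means
  have htmL : timeMean (fun s => ν * (eLaplacianNormSq (u s)).toReal) t = t⁻¹ * (ν * IL) := by
    rw [timeMean_const_mul, timeMean, intervalIntegral.integral_of_le ht.le]; ring
  have htmS : timeMean (fun s => Real.sqrt (∫ x, ‖u s x‖ ^ 2)) t = t⁻¹ * IS := by
    rw [timeMean, intervalIntegral.integral_of_le ht.le]
  have hJ := timeMean_sqrt_le_sqrt_timeMean ht hE0 hE
  rw [htmS] at hJ
  rw [htmL]
  have ht' : 0 ≤ t⁻¹ := inv_nonneg.mpr ht.le
  calc t⁻¹ * (ν * IL) ≤ t⁻¹ * (2⁻¹ * G₀ + K * IS) := mul_le_mul_of_nonneg_left hkey ht'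
    _ = G₀ / (2 * t) + K * (t⁻¹ * IS) := by field_simp
    _ ≤ G₀ / (2 * t) + K * Real.sqrt (timeMean (fun s => ∫ x, ‖u s x‖ ^ 2) t) := by
        gcongr

/-- **`χ ≤ ‖Δf‖_∞ U` under the enstrophy inequality** (Alexakis–Doering 2006, §2, arXiv v1
eq. (16) `χ ≤ k_f² U F`), on `T^d` for any `d`: for `ν > 0`, a steady force with `‖Δf‖ ≤ K`, and a
global Leray–Hopf solution with `U > 0` satisfying `ν∫₀ᵗ‖Δu‖₂² ≤ ½‖∇u₀‖₂² - ∫₀ᵗ∫⟪Δf, u⟫` for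
every `t > 0`: `χ ≤ K U` (`χ = meanEnstrophyDissipation ν u`, `limsup` averages). [cite: AlexakisDoering2006PLA, §2 eq. (16)] -/
theorem meanEnstrophyDissipation_le_of_enstrophyIneq (hν : 0 < ν)
    (hu : Torus.IsGlobalLerayHopf ν (fun _ => f) u₀ u) {K : ℝ} (hK : 0 ≤ K)
    (hfK : ∀ x, ‖Torus.laplacian f x‖ ≤ K)
    (hineq : ∀ t, 0 < t → ν * ∫ s in Ioc 0 t, (eLaplacianNormSq (u s)).toReal ≤
      2⁻¹ * (Torus.eGradNormSq u₀).toReal - ∫ s in Ioc 0 t, ∫ x, ⟪Torus.laplacian f x, u s x⟫)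
    (hU : 0 < rmsVelocity longTimeAvgSup u) :
    meanEnstrophyDissipation ν u ≤ K * rmsVelocity longTimeAvgSup u := by
  set e : ℝ → ℝ := timeMean fun s => ∫ x, ‖u s x‖ ^ 2 with he
  set G₀ := (Torus.eGradNormSq u₀).toReal with hG₀
  set U := rmsVelocity longTimeAvgSup u with hUdef
  have hU0 : 0 ≤ U := Real.sqrt_nonneg _
  have hG₀0 : 0 ≤ G₀ := ENNReal.toReal_nonneg
  -- bounded running means of the energy and their `limsup`
  have heb : IsBoundedUnder (· ≤ ·) atTop e := isBoundedUnder_timeMean_of_rmsVelocity_pos hU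
  have heU : limsup e atTop = U ^ 2 := by
    rw [hUdef, rmsVelocity, Real.sq_sqrt (meanEnergy_nonneg u)]
    rfl
  -- the eventual inequalities
  have hstep : ∀ᶠ t in atTop, timeMean (fun s => ν * (eLaplacianNormSq (u s)).toReal) t ≤
      G₀ / (2 * t) + K * Real.sqrt (e t) := by
    filter_upwards [eventually_gt_atTop (0 : ℝ)] with t ht
    exact timeMean_enstrophyDissipation_le_of_enstrophyIneq hu hK hfK hineq ht
  have hg0 : ∀ᶠ t in atTop, 0 ≤ timeMean (fun s => ν * (eLaplacianNormSq (u s)).toReal) t := by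
    filter_upwards [eventually_ge_atTop (0 : ℝ)] with t ht
    exact timeMean_nonneg (fun s => mul_nonneg hν.le ENNReal.toReal_nonneg) ht
  have hG₀t : Tendsto (fun t : ℝ => G₀ / (2 * t)) atTop (𝓝 0) := by
    have h := (tendsto_inv_atTop_zero : Tendsto (fun r : ℝ => r⁻¹) atTop (𝓝 0)).const_mul (G₀ / 2)
    rw [mul_zero] at h
    refine h.congr' ?_
    filter_upwards [eventually_gt_atTop (0 : ℝ)] with t ht
    field_simp
  -- `limsup` through `δ`
  refine limsup_le_of_forall_pos_eventually_le (h := fun δ => δ + K * Real.sqrt (U ^ 2 + δ))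
    hg0 (fun δ hδ => ?_) ?_
  · have heδ : ∀ᶠ t in atTop, e t < U ^ 2 + δ :=
      eventually_lt_of_limsup_lt (by rw [heU]; linarith) heb
    have hGδ : ∀ᶠ t in atTop, G₀ / (2 * t) ≤ δ :=
      (hG₀t.eventually (ge_mem_nhds hδ))
    filter_upwards [hstep, heδ, hGδ] with t ht heT hGT
    refine ht.trans (add_le_add hGT (mul_le_mul_of_nonneg_left (Real.sqrt_le_sqrt heT.le) hK))
  · have hc : Continuous fun δ : ℝ => δ + K * Real.sqrt (U ^ 2 + δ) :=
      continuous_id.add (continuous_const.mul ((continuous_const.add continuous_id).sqrt))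
    have h0 : (fun δ : ℝ => δ + K * Real.sqrt (U ^ 2 + δ)) 0 = K * U := by
      simp [Real.sqrt_sq hU0]
    rw [← h0]
    exact (hc.tendsto 0).mono_left nhdsWithin_le_nhds

/-- **`χ ≤ ‖Δf‖_∞ U` for 2-D Leray–Hopf solutions with smooth data, from the enstrophy balance**:
on `𝕋²`, for `ν > 0`, `f` smooth steady divergence free mean zero with `‖Δf‖ ≤ K`, `u₀` smooth
and `u` a global Leray–Hopf solution with `U > 0`, the named fact `fmrt_enstrophy_balance_torus2`
(Foias–Manley–Rosa–Temam 2001, Thm. 7.4, (A.65)) supplies the enstrophy inequality of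
`meanEnstrophyDissipation_le_of_enstrophyIneq`. [cite: AlexakisDoering2006PLA, §2 eq. (16)] -/
theorem meanEnstrophyDissipation_le_of_enstrophyBalance (hR : fmrt_enstrophy_balance_torus2)
    {ν : ℝ} (hν : 0 < ν) {f : UnitAddTorus (Fin 2) → EuclideanSpace ℝ (Fin 2)}
    (hf : Torus.IsSmooth f) (hfdiv : Torus.IsDivFree f) (hfmean : Torus.HasZeroMean f) {K : ℝ}
    (hK : 0 ≤ K) (hfK : ∀ x, ‖Torus.laplacian f x‖ ≤ K)
    {u₀ : UnitAddTorus (Fin 2) → EuclideanSpace ℝ (Fin 2)} (hu₀ : Torus.IsSmooth u₀)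
    {u : ℝ → UnitAddTorus (Fin 2) → EuclideanSpace ℝ (Fin 2)}
    (hu : Torus.IsGlobalLerayHopf ν (fun _ => f) u₀ u) (hU : 0 < rmsVelocity longTimeAvgSup u) :
    meanEnstrophyDissipation ν u ≤ K * rmsVelocity longTimeAvgSup u :=
  meanEnstrophyDissipation_le_of_enstrophyIneq hν hu hK hfK
    (fun _ ht => fmrt_enstrophy_balance_torus2.dissipation_integral_le hR hν hf hfdiv hfmean
      hu₀.memSobolev_one_complexify hu.isWeaklyDivFree_datum hu ht) hU

/-- **Discharge of eq. (16) `χ ≤ k_f² U F` relative to the 2-D enstrophy balance**: the named fact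
`fmrt_enstrophy_balance_torus2` implies the Alexakis–Doering fact
`AlexakisDoering2006_enstrophyDissipation_le` with the shape constant `a = ‖ΔΦ‖_∞ + 1`
(`‖Δ(F Φ(n • ·))‖_∞ = |F| n² ‖ΔΦ‖_∞`, `exists_norm_laplacian_force_le`). [cite: AlexakisDoering2006PLA, §2 eq. (16)] -/
theorem AlexakisDoering2006_enstrophyDissipation_le_of_enstrophyBalance
    (hR : fmrt_enstrophy_balance_torus2) : AlexakisDoering2006_enstrophyDissipation_le := by
  intro Φ
  obtain ⟨M, hM, hb⟩ := exists_norm_laplacian_force_le Φ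
  refine ⟨M + 1, by linarith, fun ν hν n hn F u₀ u hu₀ hu hU => ?_⟩
  obtain ⟨hsm, hdiv, hmean⟩ := ForcingShape.force_regular_holds Φ hn F
  have hK : 0 ≤ |F| * (n : ℝ) ^ 2 * M := by positivity
  have h := meanEnstrophyDissipation_le_of_enstrophyBalance hR hν hsm hdiv hmean hK (hb n F) hu₀ hu hU
  have hU0 : 0 ≤ rmsVelocity longTimeAvgSup u := Real.sqrt_nonneg _
  calc meanEnstrophyDissipation ν u ≤ |F| * (n : ℝ) ^ 2 * M * rmsVelocity longTimeAvgSup u := h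
    _ ≤ (M + 1) * (n : ℝ) ^ 2 * |F| * rmsVelocity longTimeAvgSup u := by
        apply mul_le_mul_of_nonneg_right _ hU0
        nlinarith [abs_nonneg F, sq_nonneg (n : ℝ), mul_nonneg (abs_nonneg F) (sq_nonneg (n : ℝ))]

end VBI

/-! ### eq. (18): the amplitude bound, unconditionally -/

section Amplitude

variable {d : Type*} [Fintype d] [DecidableEq d]

variable {ν : ℝ} {Φ : ForcingShape d} {n : ℕ} {F : ℝ}
  {u : ℝ → UnitAddTorus d → EuclideanSpace ℝ d} {u₀ : UnitAddTorus d → EuclideanSpace ℝ d}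

/-- The multiplier `Ψ = Φ(n • ·)` (the unit-amplitude force). [folklore] -/
theorem force_one_eq (Φ : ForcingShape d) (n : ℕ) : Φ.force n 1 = fun x => Φ.shape (n • x) := by
  funext x; simp [ForcingShape.force]

/-- `F Φ(n • ·) = F • Ψ` with `Ψ = Φ(n • ·)`. [folklore] -/
theorem force_eq_smul_force_one (Φ : ForcingShape d) (n : ℕ) (F : ℝ) :
    Φ.force n F = fun x => F • Φ.force n 1 x := by
  funext x; simp [ForcingShape.force]

/-- **The momentum equation tested against the shape**: for a global Leray–Hopf solution driven
by `F Φ(n • ·)` (`0 < n`) and `Ψ = Φ(n • ·)`, for every `t > 0`,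
`F t = ⟨u(t),Ψ⟩ - ⟨u₀,Ψ⟩ - ∫₀ᵗ∫⟪u,(u·∇)Ψ⟫ - ν∫₀ᵗ∫⟪u,ΔΨ⟫`
(time-sliced weak formulation with `∫⟪F Ψ, Ψ⟫ = F‖Ψ‖₂² = F`; Alexakis–Doering 2006, §2, the
display before eq. (18)). [cite: AlexakisDoering2006PLA, §2 eq. (18)] -/
theorem amplitude_mul_eq_of_isGlobalLerayHopf (hn : 0 < n)
    (hu : Torus.IsGlobalLerayHopf ν (fun _ => Φ.force n F) u₀ u) {t : ℝ} (ht : 0 < t) :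
    F * t = (∫ x, ⟪u t x, Φ.force n 1 x⟫) - (∫ x, ⟪u₀ x, Φ.force n 1 x⟫) -
      (∫ s in Ioc 0 t, ∫ x, ⟪u s x, Torus.convect (u s) (Φ.force n 1) x⟫) -
        ν * ∫ s in Ioc 0 t, ∫ x, ⟪u s x, Torus.laplacian (Φ.force n 1) x⟫ := by
  obtain ⟨hΨ, hΨdiv, -⟩ := ForcingShape.force_regular_holds Φ hn (1 : ℝ)
  obtain ⟨hfs, -, -⟩ := ForcingShape.force_regular_holds Φ hn F
  set Ψ := Φ.force n 1 with hΨdef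
  have hfm := aestronglyMeasurable_stLift_const hfs (volume.restrict (Ioo 0 t ×ˢ univ))
  have hf₂ := lintegral_enorm_sq_const_lt_top hfs t
  have hid := (hu t ht).integral_inner_eq_add_setIntegral ht hfm hf₂ hΨ hΨdiv ⟨ht, le_rfl⟩
  -- the force pairing is the constant `F`
  have hnormsq : ∫ x, ‖Ψ x‖ ^ 2 = 1 := by
    have h := ForcingShape.integral_norm_sq_force_holds Φ hn (1 : ℝ)
    rwa [one_pow] at h
  have hfΨ : ∀ x, ⟪Φ.force n F x, Ψ x⟫ = F * ‖Ψ x‖ ^ 2 := fun x => by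
    rw [force_eq_smul_force_one Φ n F]
    simp only [← hΨdef, real_inner_smul_left, real_inner_self_eq_norm_sq]
  -- split the flux
  have hmem : ∀ s ∈ Ioc (0 : ℝ) t, MemLp (u s) 2 volume := fun s hs => hu.memLp_two hs.1.le
  have hsplit : ∀ s ∈ Ioc (0 : ℝ) t,
      (∫ x, (⟪u s x, Torus.convect (u s) Ψ x⟫ + ν * ⟪u s x, Torus.laplacian Ψ x⟫ +
        ⟪Φ.force n F x, Ψ x⟫)) =
      (∫ x, ⟪u s x, Torus.convect (u s) Ψ x⟫) + ν * (∫ x, ⟪u s x, Torus.laplacian Ψ x⟫) + F := by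
    intro s hs
    have i1 := Torus.integrable_inner_convect_self (hmem s hs) hΨ
    have i2 : Integrable (fun x => ⟪u s x, Torus.laplacian Ψ x⟫) volume :=
      Torus.integrable_inner_of_continuous ((hmem s hs).integrable one_le_two)
        hΨ.laplacian.continuous
    have i3 : Integrable (fun x => ⟪Φ.force n F x, Ψ x⟫) volume :=
      Torus.integrable_inner_of_continuous ((hfs.memLp 2).integrable one_le_two) hΨ.continuous
    have i12 : Integrable (fun x => ⟪u s x, Torus.convect (u s) Ψ x⟫ +
        ν * ⟪u s x, Torus.laplacian Ψ x⟫) volume := i1.add (i2.const_mul ν)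
    rw [integral_add i12 i3, integral_add i1 (i2.const_mul ν), integral_const_mul]
    simp only [hfΨ]
    rw [integral_const_mul, hnormsq, mul_one]
  -- integrability of the pieces on `(0, t]`
  have hD : IntegrableOn (fun s => ∫ x, ⟪u s x, Torus.laplacian Ψ x⟫) (Ioc 0 t) :=
    (integrableOn_Ioc_iff_integrableOn_Ioo).mpr
      ((hu t ht).integrableOn_integral_inner hΨ.laplacian.continuous)
  have hFl : IntegrableOn (fun s => ∫ x, (⟪u s x, Torus.convect (u s) Ψ x⟫ +
      ν * ⟪u s x, Torus.laplacian Ψ x⟫ + ⟪Φ.force n F x, Ψ x⟫)) (Ioc 0 t) :=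
    (integrableOn_Ioc_iff_integrableOn_Ioo).mpr ((hu t ht).integrableOn_flux hfm hf₂ hΨ)
  haveI : IsFiniteMeasure (volume.restrict (Ioc (0 : ℝ) t)) :=
    isFiniteMeasure_restrict.mpr measure_Ioc_lt_top.ne
  have hC : IntegrableOn (fun s => ∫ x, ⟪u s x, Torus.convect (u s) Ψ x⟫) (Ioc 0 t) := by
    have h : IntegrableOn (fun s => (∫ x, (⟪u s x, Torus.convect (u s) Ψ x⟫ +
        ν * ⟪u s x, Torus.laplacian Ψ x⟫ + ⟪Φ.force n F x, Ψ x⟫)) -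
        ν * (∫ x, ⟪u s x, Torus.laplacian Ψ x⟫) - F) (Ioc 0 t) :=
      (hFl.sub (hD.const_mul ν)).sub (integrableOn_const measure_Ioc_lt_top.ne)
    refine h.congr_fun (fun s hs => ?_) measurableSet_Ioc
    simp only
    rw [hsplit s hs]
    ring
  -- integrate the split flux
  have hint : ∫ s in Ioc 0 t, (∫ x, (⟪u s x, Torus.convect (u s) Ψ x⟫ +
      ν * ⟪u s x, Torus.laplacian Ψ x⟫ + ⟪Φ.force n F x, Ψ x⟫)) =
      (∫ s in Ioc 0 t, ∫ x, ⟪u s x, Torus.convect (u s) Ψ x⟫) +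
        ν * (∫ s in Ioc 0 t, ∫ x, ⟪u s x, Torus.laplacian Ψ x⟫) + F * t := by
    have hCD : IntegrableOn (fun s => (∫ x, ⟪u s x, Torus.convect (u s) Ψ x⟫) +
        ν * (∫ x, ⟪u s x, Torus.laplacian Ψ x⟫)) (Ioc 0 t) := hC.add (hD.const_mul ν)
    rw [setIntegral_congr_fun measurableSet_Ioc hsplit, integral_add hCD (integrable_const F),
      integral_add hC (hD.const_mul ν), integral_const_mul]
    congr 1
    rw [setIntegral_const, Real.volume_real_Ioc_of_le ht.le, sub_zero, smul_eq_mul, mul_comm]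
  beta_reduce at hid
  rw [hint] at hid
  linarith

/-- **The pointwise-in-time amplitude bound**: with `‖Ψ‖ ≤ KP`, `∑ᵢ‖∂ᵢΨ‖ ≤ C`, `‖ΔΨ‖ ≤ KL`,
`E(s) = ‖u(s)‖₂²`, for every `t > 0`,
`|F| t ≤ KP (E(t))^{1/2} + |⟨u₀,Ψ⟩| + C ∫₀ᵗ E + |ν| KL ∫₀ᵗ √E`. [cite: AlexakisDoering2006PLA, §2 eq. (18)] -/
theorem abs_amplitude_mul_le_of_isGlobalLerayHopf (hn : 0 < n)
    (hu : Torus.IsGlobalLerayHopf ν (fun _ => Φ.force n F) u₀ u)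
    {KP C KL : ℝ} (hKP : 0 ≤ KP) (hKL : 0 ≤ KL) (hP : ∀ x, ‖Φ.force n 1 x‖ ≤ KP)
    (hCΨ : ∀ x, ∑ i, ‖Torus.partialDeriv i (Φ.force n 1) x‖ ≤ C)
    (hL : ∀ x, ‖Torus.laplacian (Φ.force n 1) x‖ ≤ KL) {t : ℝ} (ht : 0 < t) :
    |F| * t ≤ KP * Real.sqrt (∫ x, ‖u t x‖ ^ 2) + |∫ x, ⟪u₀ x, Φ.force n 1 x⟫| +
      C * (∫ s in Ioc 0 t, ∫ x, ‖u s x‖ ^ 2) +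
        |ν| * KL * ∫ s in Ioc 0 t, Real.sqrt (∫ x, ‖u s x‖ ^ 2) := by
  obtain ⟨hΨ, -, -⟩ := ForcingShape.force_regular_holds Φ hn (1 : ℝ)
  set Ψ := Φ.force n 1 with hΨdef
  have hid := amplitude_mul_eq_of_isGlobalLerayHopf hn hu ht
  have hE := hu.integrableOn_integral_norm_sq ht
  have hsqE := hu.integrableOn_sqrt_integral_norm_sq ht
  -- the four bounds
  have b1 : |∫ x, ⟪u t x, Ψ x⟫| ≤ KP * Real.sqrt (∫ x, ‖u t x‖ ^ 2) := by
    have hm := hu.memLp_two ht.le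
    exact (Torus.abs_integral_inner_le_of_norm_le (hm.integrable one_le_two) hP).trans
      (mul_le_mul_of_nonneg_left (integral_norm_le_sqrt_integral_norm_sq hm) hKP)
  have b3 : |∫ s in Ioc 0 t, ∫ x, ⟪u s x, Torus.convect (u s) Ψ x⟫| ≤
      C * ∫ s in Ioc 0 t, ∫ x, ‖u s x‖ ^ 2 := by
    rw [← integral_const_mul]
    refine abs_integral_le_integral_abs.trans (integral_mono_of_nonneg
      (ae_of_all _ fun s => abs_nonneg _) (hE.const_mul C) ?_)
    filter_upwards [ae_restrict_mem measurableSet_Ioc] with s hs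
    exact Torus.abs_integral_inner_convect_self_le (hu.memLp_two hs.1.le) hΨ hCΨ
  have b4 : |∫ s in Ioc 0 t, ∫ x, ⟪u s x, Torus.laplacian Ψ x⟫| ≤
      KL * ∫ s in Ioc 0 t, Real.sqrt (∫ x, ‖u s x‖ ^ 2) := by
    rw [← integral_const_mul]
    refine abs_integral_le_integral_abs.trans (integral_mono_of_nonneg
      (ae_of_all _ fun s => abs_nonneg _) (hsqE.const_mul KL) ?_)
    filter_upwards [ae_restrict_mem measurableSet_Ioc] with s hs
    have hm := hu.memLp_two hs.1.le
    exact (Torus.abs_integral_inner_le_of_norm_le (hm.integrable one_le_two) hL).trans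
      (mul_le_mul_of_nonneg_left (integral_norm_le_sqrt_integral_norm_sq hm) hKL)
  have b4' : |ν * ∫ s in Ioc 0 t, ∫ x, ⟪u s x, Torus.laplacian Ψ x⟫| ≤
      |ν| * KL * ∫ s in Ioc 0 t, Real.sqrt (∫ x, ‖u s x‖ ^ 2) := by
    rw [abs_mul, mul_assoc]
    exact mul_le_mul_of_nonneg_left b4 (abs_nonneg ν)
  -- combine
  have habs : |F| * t = |F * t| := by rw [abs_mul, abs_of_pos ht]
  rw [habs, hid]
  calc |(∫ x, ⟪u t x, Ψ x⟫) - (∫ x, ⟪u₀ x, Ψ x⟫) -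
        (∫ s in Ioc 0 t, ∫ x, ⟪u s x, Torus.convect (u s) Ψ x⟫) -
          ν * ∫ s in Ioc 0 t, ∫ x, ⟪u s x, Torus.laplacian Ψ x⟫|
      ≤ |∫ x, ⟪u t x, Ψ x⟫| + |∫ x, ⟪u₀ x, Ψ x⟫| +
          |∫ s in Ioc 0 t, ∫ x, ⟪u s x, Torus.convect (u s) Ψ x⟫| +
            |ν * ∫ s in Ioc 0 t, ∫ x, ⟪u s x, Torus.laplacian Ψ x⟫| := by
        refine (abs_sub _ _).trans (add_le_add ((abs_sub _ _).trans (add_le_add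
          (abs_sub _ _) le_rfl)) le_rfl)
    _ ≤ _ := by linarith


/-! #### Growth of the energy: `‖u(t)‖₂² = O(t)` -/

/-- **Energy growth from the energy inequality**: for a global Leray–Hopf solution driven by
`F Φ(n • ·)` with `ν ≥ 0`, `‖Φ(n • ·)‖ ≤ KP`, for every `t > 0`,
`‖u(t)‖₂² ≤ ‖u₀‖₂² + 2|F| KP ∫₀ᵗ (‖u(s)‖₂²)^{1/2} ds` (Leray's energy inequality from `0`,
the dissipation dropped, `|∫⟪f, u⟫| ≤ |F|‖Ψ‖_∞‖u‖₁ ≤ |F| KP ‖u‖₂`). [folklore] -/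
theorem integral_norm_sq_le_of_isGlobalLerayHopf (hν : 0 ≤ ν)
    (hu : Torus.IsGlobalLerayHopf ν (fun _ => Φ.force n F) u₀ u) {KP : ℝ} (hKP : 0 ≤ KP)
    (hP : ∀ x, ‖Φ.force n 1 x‖ ≤ KP) {t : ℝ} (ht : 0 < t) :
    ∫ x, ‖u t x‖ ^ 2 ≤ (∫ x, ‖u₀ x‖ ^ 2) +
      2 * |F| * KP * ∫ s in Ioc 0 t, Real.sqrt (∫ x, ‖u s x‖ ^ 2) := by
  have hen := (hu t ht).energy_ineq_zero t ⟨ht.le, le_rfl⟩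
  have hdiss : 0 ≤ ν * (∫⁻ τ in Ioo 0 t, Torus.eGradNormSq (u τ)).toReal :=
    mul_nonneg hν ENNReal.toReal_nonneg
  have hsqE := hu.integrableOn_sqrt_integral_norm_sq ht
  -- the forcing integral
  have hfP : ∀ s ∈ Ioc (0 : ℝ) t, |∫ x, ⟪Φ.force n F x, u s x⟫| ≤
      |F| * KP * Real.sqrt (∫ x, ‖u s x‖ ^ 2) := by
    intro s hs
    have hm := hu.memLp_two hs.1.le
    have hbd : ∀ x, ‖Φ.force n F x‖ ≤ |F| * KP := fun x => by
      rw [force_eq_smul_force_one Φ n F]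
      simp only [norm_smul, Real.norm_eq_abs]
      exact mul_le_mul_of_nonneg_left (hP x) (abs_nonneg F)
    exact abs_integral_inner_le_mul_sqrt hm (by positivity) hbd
  have hforce : ∫ τ in (0 : ℝ)..t, ∫ x, ⟪Φ.force n F x, u τ x⟫ ≤
      |F| * KP * ∫ s in Ioc 0 t, Real.sqrt (∫ x, ‖u s x‖ ^ 2) := by
    rw [intervalIntegral.integral_of_le ht.le, ← integral_const_mul]
    refine (le_abs_self _).trans (abs_integral_le_integral_abs.trans
      (integral_mono_of_nonneg (ae_of_all _ fun s => abs_nonneg _) (hsqE.const_mul _) ?_))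
    filter_upwards [ae_restrict_mem measurableSet_Ioc] with s hs
    exact hfP s hs
  have hKE : ∀ v : UnitAddTorus d → EuclideanSpace ℝ d, Torus.kineticEnergy v = 2⁻¹ * ∫ x, ‖v x‖ ^ 2 :=
    fun v => rfl
  beta_reduce at hen
  rw [hKE, hKE] at hen
  nlinarith [hen, hforce, hdiss]


/-! #### The `limsup`: `|F| ≤ ‖∇Ψ‖_∞ U² + ν ‖ΔΨ‖_∞ U` -/

omit [Fintype d] [DecidableEq d] in
/-- `√(A + c t)/t → 0` as `t → ∞` (real square root, junk included). [folklore] -/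
theorem tendsto_sqrt_add_mul_div_atTop (A c : ℝ) :
    Tendsto (fun t : ℝ => Real.sqrt (A + c * t) / t) atTop (𝓝 0) := by
  have h1 : Tendsto (fun t : ℝ => A * (t ^ 2)⁻¹ + c * t⁻¹) atTop (𝓝 (A * 0 + c * 0)) :=
    ((tendsto_pow_atTop two_ne_zero).inv_tendsto_atTop.const_mul A).add
      (tendsto_inv_atTop_zero.const_mul c)
  rw [mul_zero, mul_zero, add_zero] at h1
  have h2 := (Real.continuous_sqrt.tendsto 0).comp h1
  rw [Real.sqrt_zero] at h2
  refine h2.congr' ?_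
  filter_upwards [eventually_gt_atTop (0 : ℝ)] with t ht
  simp only [Function.comp_apply]
  rw [show A * (t ^ 2)⁻¹ + c * t⁻¹ = (A + c * t) / t ^ 2 by field_simp, Real.sqrt_div' _ (sq_nonneg t),
    Real.sqrt_sq ht.le]

/-- **The Alexakis–Doering / Doering–Foias amplitude bound for Leray–Hopf solutions** (any `d`):
for a global Leray–Hopf solution on `T^d` driven by `F Φ(n • ·)` (`ν > 0`, `0 < n`) with
`U = ⟨‖u‖₂²⟩^{1/2} > 0`, and bounds `∑ᵢ‖∂ᵢΨ‖ ≤ C`, `‖ΔΨ‖ ≤ KL` for the multiplier `Ψ = Φ(n • ·)`,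
one has `|F| ≤ C U² + ν KL U` (Alexakis–Doering 2006, §2, arXiv v1 eq. (18); Doering–Foias
2002, §3). [cite: AlexakisDoering2006PLA, §2 eq. (18)] -/
theorem abs_amplitude_le_of_isGlobalLerayHopf (hν : 0 < ν) (hn : 0 < n)
    (hu : Torus.IsGlobalLerayHopf ν (fun _ => Φ.force n F) u₀ u) {C KL : ℝ} (hC : 0 ≤ C)
    (hKL : 0 ≤ KL) (hCΨ : ∀ x, ∑ i, ‖Torus.partialDeriv i (Φ.force n 1) x‖ ≤ C)
    (hL : ∀ x, ‖Torus.laplacian (Φ.force n 1) x‖ ≤ KL) (hU : 0 < rmsVelocity longTimeAvgSup u) :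
    |F| ≤ C * rmsVelocity longTimeAvgSup u ^ 2 + ν * KL * rmsVelocity longTimeAvgSup u := by
  obtain ⟨hΨ, -, -⟩ := ForcingShape.force_regular_holds Φ hn (1 : ℝ)
  obtain ⟨KP, hKP, hP⟩ := Torus.exists_nonneg_forall_norm_le_of_continuous hΨ.continuous
  have hU0 : 0 ≤ rmsVelocity longTimeAvgSup u := Real.sqrt_nonneg _
  have hE0 : ∀ s, 0 ≤ ∫ x, ‖u s x‖ ^ 2 := fun s => integral_nonneg fun x => sq_nonneg _
  -- bounded running means of the energy and their `limsup`
  have heb : IsBoundedUnder (· ≤ ·) atTop (timeMean fun s => ∫ x, ‖u s x‖ ^ 2) :=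
    isBoundedUnder_timeMean_of_rmsVelocity_pos hU
  have heU : limsup (timeMean fun s => ∫ x, ‖u s x‖ ^ 2) atTop = rmsVelocity longTimeAvgSup u ^ 2 := by
    rw [rmsVelocity, Real.sq_sqrt (meanEnergy_nonneg u)]
    rfl
  obtain ⟨B, hB⟩ := heb
  rw [Filter.eventually_map] at hB
  -- Cauchy–Schwarz for the running means of `√E`
  have hIS : ∀ t, 0 < t → (∫ s in Ioc 0 t, Real.sqrt (∫ x, ‖u s x‖ ^ 2)) ≤
      t * Real.sqrt (timeMean (fun s => ∫ x, ‖u s x‖ ^ 2) t) := by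
    intro t ht
    have hJ := timeMean_sqrt_le_sqrt_timeMean ht hE0 (hu.integrableOn_integral_norm_sq ht)
    rw [timeMean, intervalIntegral.integral_of_le ht.le] at hJ
    have h2 := mul_le_mul_of_nonneg_left hJ ht.le
    rwa [← mul_assoc, mul_inv_cancel₀ ht.ne', one_mul] at h2
  have hIE : ∀ t, 0 < t → (∫ s in Ioc 0 t, ∫ x, ‖u s x‖ ^ 2) =
      t * timeMean (fun s => ∫ x, ‖u s x‖ ^ 2) t := by
    intro t ht
    rw [timeMean, intervalIntegral.integral_of_le ht.le, ← mul_assoc, mul_inv_cancel₀ ht.ne',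
      one_mul]
  -- running-mean form of the pointwise bound, for `t > 0`
  have hstep : ∀ t, 0 < t → |F| ≤ KP * Real.sqrt (∫ x, ‖u t x‖ ^ 2) / t +
      |∫ x, ⟪u₀ x, Φ.force n 1 x⟫| / t + C * timeMean (fun s => ∫ x, ‖u s x‖ ^ 2) t +
        |ν| * KL * Real.sqrt (timeMean (fun s => ∫ x, ‖u s x‖ ^ 2) t) := by
    intro t ht
    have h := abs_amplitude_mul_le_of_isGlobalLerayHopf hn hu hKP hKL hP hCΨ hL ht
    rw [hIE t ht] at h
    have h3 := mul_le_mul_of_nonneg_left (hIS t ht) (mul_nonneg (abs_nonneg ν) hKL)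
    have h' : |F| * t ≤ KP * Real.sqrt (∫ x, ‖u t x‖ ^ 2) + |∫ x, ⟪u₀ x, Φ.force n 1 x⟫| +
        C * (t * timeMean (fun s => ∫ x, ‖u s x‖ ^ 2) t) +
          |ν| * KL * (t * Real.sqrt (timeMean (fun s => ∫ x, ‖u s x‖ ^ 2) t)) := by
      linarith
    rw [← le_div_iff₀ ht] at h'
    refine h'.trans_eq ?_
    field_simp
  -- the energy grows at most linearly: `E t ≤ E₀ + (2|F| KP √B₊) t` eventually
  have hgrowth : ∀ᶠ t in atTop, ∫ x, ‖u t x‖ ^ 2 ≤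
      (∫ x, ‖u₀ x‖ ^ 2) + (2 * |F| * KP * Real.sqrt (max B 0)) * t := by
    filter_upwards [hB, eventually_gt_atTop (0 : ℝ)] with t hBt ht
    have h := integral_norm_sq_le_of_isGlobalLerayHopf hν.le hu hKP hP ht
    have h2 : Real.sqrt (timeMean (fun s => ∫ x, ‖u s x‖ ^ 2) t) ≤ Real.sqrt (max B 0) :=
      Real.sqrt_le_sqrt (hBt.trans (le_max_left _ _))
    have h3 : (∫ s in Ioc 0 t, Real.sqrt (∫ x, ‖u s x‖ ^ 2)) ≤ t * Real.sqrt (max B 0) :=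
      (hIS t ht).trans (mul_le_mul_of_nonneg_left h2 ht.le)
    have h4 := mul_le_mul_of_nonneg_left h3 (by positivity : 0 ≤ 2 * |F| * KP)
    linarith
  have hvanish : Tendsto (fun t => KP * Real.sqrt ((∫ x, ‖u₀ x‖ ^ 2) +
      (2 * |F| * KP * Real.sqrt (max B 0)) * t) / t + |∫ x, ⟪u₀ x, Φ.force n 1 x⟫| / t)
      atTop (𝓝 0) := by
    have h1 := (tendsto_sqrt_add_mul_div_atTop (∫ x, ‖u₀ x‖ ^ 2)
      (2 * |F| * KP * Real.sqrt (max B 0))).const_mul KP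
    have h2 := (tendsto_inv_atTop_zero : Tendsto (fun r : ℝ => r⁻¹) atTop (𝓝 0)).const_mul
      |∫ x, ⟪u₀ x, Φ.force n 1 x⟫|
    rw [mul_zero] at h1 h2
    have h := h1.add h2
    rw [add_zero] at h
    refine h.congr' ?_
    filter_upwards [eventually_gt_atTop (0 : ℝ)] with t ht
    simp only [div_eq_mul_inv]
    ring
  -- the `δ`-argument on the constant `|F|`
  have key : ∀ δ, 0 < δ → |F| ≤ δ + C * (rmsVelocity longTimeAvgSup u ^ 2 + δ) +
      |ν| * KL * Real.sqrt (rmsVelocity longTimeAvgSup u ^ 2 + δ) := by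
    intro δ hδ
    have heδ : ∀ᶠ t in atTop, timeMean (fun s => ∫ x, ‖u s x‖ ^ 2) t <
        rmsVelocity longTimeAvgSup u ^ 2 + δ :=
      eventually_lt_of_limsup_lt (by rw [heU]; linarith) ⟨B, Filter.eventually_map.mpr hB⟩
    have hvδ := hvanish.eventually (gt_mem_nhds hδ)
    obtain ⟨t, ht0, hgt, het, hvt⟩ :=
      ((eventually_gt_atTop (0 : ℝ)).and (hgrowth.and (heδ.and hvδ))).exists
    have h1 : KP * Real.sqrt (∫ x, ‖u t x‖ ^ 2) / t ≤
        KP * Real.sqrt ((∫ x, ‖u₀ x‖ ^ 2) + (2 * |F| * KP * Real.sqrt (max B 0)) * t) / t :=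
      div_le_div_of_nonneg_right (mul_le_mul_of_nonneg_left (Real.sqrt_le_sqrt hgt) hKP) ht0.le
    have h2 : C * timeMean (fun s => ∫ x, ‖u s x‖ ^ 2) t ≤
        C * (rmsVelocity longTimeAvgSup u ^ 2 + δ) := mul_le_mul_of_nonneg_left het.le hC
    have h3 : |ν| * KL * Real.sqrt (timeMean (fun s => ∫ x, ‖u s x‖ ^ 2) t) ≤
        |ν| * KL * Real.sqrt (rmsVelocity longTimeAvgSup u ^ 2 + δ) :=
      mul_le_mul_of_nonneg_left (Real.sqrt_le_sqrt het.le) (mul_nonneg (abs_nonneg ν) hKL)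
    linarith [hstep t ht0]
  have hcont : Continuous fun δ : ℝ => δ + C * (rmsVelocity longTimeAvgSup u ^ 2 + δ) +
      |ν| * KL * Real.sqrt (rmsVelocity longTimeAvgSup u ^ 2 + δ) :=
    (continuous_id.add (continuous_const.mul (continuous_const.add continuous_id))).add
      (continuous_const.mul ((continuous_const.add continuous_id).sqrt))
  have h0 : (fun δ : ℝ => δ + C * (rmsVelocity longTimeAvgSup u ^ 2 + δ) +
      |ν| * KL * Real.sqrt (rmsVelocity longTimeAvgSup u ^ 2 + δ)) 0 =
      C * rmsVelocity longTimeAvgSup u ^ 2 + ν * KL * rmsVelocity longTimeAvgSup u := by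
    simp [Real.sqrt_sq hU0, abs_of_pos hν]
  rw [← h0]
  have hlim : Tendsto (fun δ : ℝ => δ + C * (rmsVelocity longTimeAvgSup u ^ 2 + δ) +
      |ν| * KL * Real.sqrt (rmsVelocity longTimeAvgSup u ^ 2 + δ)) (𝓝[>] 0)
      (𝓝 ((fun δ : ℝ => δ + C * (rmsVelocity longTimeAvgSup u ^ 2 + δ) +
        |ν| * KL * Real.sqrt (rmsVelocity longTimeAvgSup u ^ 2 + δ)) 0)) :=
    (hcont.tendsto 0).mono_left nhdsWithin_le_nhds
  exact ge_of_tendsto hlim (by filter_upwards [self_mem_nhdsWithin] with δ hδ using key δ hδ)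

/-- **Discharge of the Alexakis–Doering amplitude fact** (`AlexakisDoering2006_amplitude_le`,
Alexakis–Doering 2006, §2, arXiv v1 eq. (18)): for every forcing shape `Φ` on `T²`, with
`a = ‖∑ᵢ‖∂ᵢΦ‖‖_∞ + 1`, `b = ‖ΔΦ‖_∞ + 1`, every global Leray–Hopf solution driven by
`F Φ(n • ·)` with `U > 0` obeys `|F| ≤ a U²/ℓ + b ν U/ℓ²`, `ℓ = 1/n`
(`abs_amplitude_le_of_isGlobalLerayHopf` with `∑ᵢ‖∂ᵢ(Φ(n • ·))‖ ≤ n ‖∑ᵢ‖∂ᵢΦ‖‖_∞`,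
`‖Δ(Φ(n • ·))‖ ≤ n²‖ΔΦ‖_∞`). [cite: AlexakisDoering2006PLA, §2 eq. (18)] -/
theorem AlexakisDoering2006_amplitude_le_holds : AlexakisDoering2006_amplitude_le := by
  intro Φ
  obtain ⟨D, hD, hDb⟩ := exists_sum_norm_partialDeriv_comp_nsmul_le Φ
  obtain ⟨M, hM, hMb⟩ := exists_norm_laplacian_force_le Φ
  refine ⟨D + 1, M + 1, by linarith, by linarith, fun ν hν n hn F u₀ u hu hU => ?_⟩
  set U := rmsVelocity longTimeAvgSup u with hUdef
  have hU0 : 0 ≤ U := Real.sqrt_nonneg _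
  have hn' : (0 : ℝ) < n := by exact_mod_cast hn
  -- the multiplier bounds for `Ψ = Φ(n • ·) = Φ.force n 1`
  have hCΨ : ∀ x, ∑ i, ‖Torus.partialDeriv i (Φ.force n 1) x‖ ≤ (n : ℝ) * D := fun x => by
    rw [force_one_eq]; exact hDb n x
  have hL : ∀ x, ‖Torus.laplacian (Φ.force n 1) x‖ ≤ (n : ℝ) ^ 2 * M := fun x => by
    have h := hMb n 1 x
    rwa [abs_one, one_mul] at h
  have h := abs_amplitude_le_of_isGlobalLerayHopf hν hn hu (by positivity) (by positivity) hCΨ hL hU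
  -- rewrite in the `ℓ = 1/n` form
  have e1 : (D + 1) * U ^ 2 / (n : ℝ)⁻¹ = (n : ℝ) * (D + 1) * U ^ 2 := by field_simp
  have e2 : (M + 1) * ν * U / (n : ℝ)⁻¹ ^ 2 = ν * ((n : ℝ) ^ 2 * (M + 1)) * U := by field_simp
  rw [e1, e2]
  have h1 : (n : ℝ) * D * U ^ 2 ≤ (n : ℝ) * (D + 1) * U ^ 2 := by
    have : 0 ≤ (n : ℝ) * U ^ 2 := by positivity
    nlinarith
  have h2 : ν * ((n : ℝ) ^ 2 * M) * U ≤ ν * ((n : ℝ) ^ 2 * (M + 1)) * U := by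
    have : 0 ≤ ν * (n : ℝ) ^ 2 * U := by positivity
    nlinarith
  linarith

end Amplitude

end Literature.Analysis.FluidPDE

end
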